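import Mathlib.RingTheory.MvPolynomial.Symmetric.NewtonIdentities
import Mathlib.FieldTheory.IsAlgClosed.Basic
import Mathlib.RingTheory.Polynomial.Vieta
import HarnessLib

/-!
# Prescribed power sums over an algebraically closed field of characteristic zero

For every `r` and every target sequence `a : ℕ → k` over an algebraically closed field `k` of
characteristic zero there are `γ₀, …, γ_{r-1} ∈ k` with

  `∑ᵢ γᵢ ^ m = a m` for all `1 ≤ m ≤ r`

(`exists_powerSum_eq`): the power-sum map `k^r → k^r` is onto. Proof (folklore): solve Newton's
identities for elementary symmetric values `e₁, …, e_r` (`exists_newtonRel`; this is where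
`m⁻¹ ∈ k` is used), take the `r` roots of the monic polynomial with these signed coefficients
(`IsAlgClosed.splits`, Vieta `Polynomial.coeff_eq_esymm_roots_of_card`), and run Newton's
identities forward (`MvPolynomial.psum_eq_mul_esymm_sub_sum`) by strong induction on `m`.

Used by `Literature.Computability.AlgebraicComplexity.EvenCycleCoverVNP` (a transfer matrix with
`tr (W ^ ℓ) = [ℓ even]` for `ℓ ≤ n`). Mathlib has Newton's identities and Vieta's formula but not
this surjectivity statement (searched `psum`, `esymm`, `powerSum`).
-/

namespace Literature.RingTheory.MvPolynomial

open Polynomial Finset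

variable {k : Type*} [Field k]

/-- **Solving Newton's identities for the elementary symmetric values**: for targets `a` there are
`e` with `e 0 = 1` and, for `1 ≤ j ≤ r`, Newton's relation in the shape of
`MvPolynomial.psum_eq_mul_esymm_sub_sum`,
`a j = (-1)^(j+1) j e j - ∑_{0 < i < j} (-1)^i e i a (j - i)` (characteristic zero: `e j` is
obtained by dividing by `j`). [folklore] -/
theorem exists_newtonRel [CharZero k] (a : ℕ → k) (r : ℕ) :
    ∃ e : ℕ → k, e 0 = 1 ∧ ∀ j, 1 ≤ j → j ≤ r →
      a j = (-1) ^ (j + 1) * j * e j -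
        ∑ x ∈ (antidiagonal j).filter (fun x => x.1 ∈ Set.Ioo 0 j),
          (-1) ^ x.1 * e x.1 * a x.2 := by
  induction r with
  | zero => exact ⟨fun _ => 1, rfl, fun j h1 h2 => by omega⟩
  | succ r ih =>
    obtain ⟨e, he0, he⟩ := ih
    set S : k := ∑ x ∈ (antidiagonal (r + 1)).filter (fun x => x.1 ∈ Set.Ioo 0 (r + 1)),
      (-1) ^ x.1 * e x.1 * a x.2 with hS
    set u : k := (-1) ^ (r + 1 + 1) with hu
    set v : k := u * (a (r + 1) + S) / ((r + 1 : ℕ) : k) with hv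
    refine ⟨Function.update e (r + 1) v, by rw [Function.update_of_ne (by omega), he0], ?_⟩
    intro j hj1 hj2
    -- the sums only see indices `< j ≤ r + 1`, where the update is invisible
    have hsum : ∀ j', j' ≤ r + 1 →
        ∑ x ∈ (antidiagonal j').filter (fun x => x.1 ∈ Set.Ioo 0 j'),
          (-1) ^ x.1 * Function.update e (r + 1) v x.1 * a x.2 =
        ∑ x ∈ (antidiagonal j').filter (fun x => x.1 ∈ Set.Ioo 0 j'),
          (-1) ^ x.1 * e x.1 * a x.2 := by
      intro j' hj'
      refine Finset.sum_congr rfl fun x hx => ?_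
      simp only [Finset.mem_filter, Set.mem_Ioo] at hx
      rw [Function.update_of_ne (by omega)]
    rcases Nat.lt_or_ge j (r + 1) with hlt | hge
    · rw [hsum j (by omega), Function.update_of_ne (by omega)]
      exact he j hj1 (by omega)
    · have hj : j = r + 1 := le_antisymm hj2 hge
      subst hj
      rw [hsum (r + 1) le_rfl, Function.update_self, ← hS, hv, ← hu]
      have hr : ((r + 1 : ℕ) : k) ≠ 0 := by exact_mod_cast Nat.succ_ne_zero r
      have hsq : u * u = 1 := by
        rw [hu, ← mul_pow, neg_one_mul, neg_neg, one_pow]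
      have key : u * ((r + 1 : ℕ) : k) * (u * (a (r + 1) + S) / ((r + 1 : ℕ) : k)) =
          a (r + 1) + S := by
        calc u * ((r + 1 : ℕ) : k) * (u * (a (r + 1) + S) / ((r + 1 : ℕ) : k))
            = (u * u) * (a (r + 1) + S) * (((r + 1 : ℕ) : k) / ((r + 1 : ℕ) : k)) := by ring
          _ = a (r + 1) + S := by rw [hsq, div_self hr, one_mul, mul_one]
      rw [key]
      ring

/-- The monic polynomial `X^r - e₁ X^{r-1} + e₂ X^{r-2} - ⋯ ± e_r` with prescribed signed
elementary symmetric coefficients. [folklore] -/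
noncomputable def newtonPoly (e : ℕ → k) (r : ℕ) : k[X] :=
  ∑ j ∈ range (r + 1), monomial (r - j) ((-1) ^ j * e j)

/-- Coefficients of `newtonPoly`. [folklore] -/
theorem coeff_newtonPoly (e : ℕ → k) (r : ℕ) {j : ℕ} (hj : j ≤ r) :
    (newtonPoly e r).coeff (r - j) = (-1) ^ j * e j := by
  unfold newtonPoly
  rw [finsetSum_coeff]
  simp only [coeff_monomial]
  rw [Finset.sum_eq_single j]
  · rw [if_pos rfl]
  · intro j' hj' hne
    rw [if_neg]
    intro h
    rw [Finset.mem_range] at hj'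
    omega
  · intro h
    rw [Finset.mem_range] at h
    omega

/-- Coefficients of `newtonPoly` above the top vanish. [folklore] -/
theorem coeff_newtonPoly_eq_zero (e : ℕ → k) (r : ℕ) {i : ℕ} (hi : r < i) :
    (newtonPoly e r).coeff i = 0 := by
  unfold newtonPoly
  rw [finsetSum_coeff]
  refine Finset.sum_eq_zero fun j _ => ?_
  rw [coeff_monomial, if_neg]
  omega

/-- `newtonPoly e r` has degree `r` and is monic when `e 0 = 1`. [folklore] -/
theorem natDegree_newtonPoly (e : ℕ → k) (r : ℕ) (he : e 0 = 1) :
    (newtonPoly e r).natDegree = r ∧ (newtonPoly e r).Monic := by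
  have htop : (newtonPoly e r).coeff r = 1 := by
    have := coeff_newtonPoly e r (Nat.zero_le r)
    rw [Nat.sub_zero] at this
    rw [this, he, pow_zero, one_mul]
  have hle : (newtonPoly e r).natDegree ≤ r := by
    rw [natDegree_le_iff_coeff_eq_zero]
    intro i hi
    exact coeff_newtonPoly_eq_zero e r (by exact_mod_cast hi)
  have hdeg : (newtonPoly e r).natDegree = r :=
    le_antisymm hle (le_natDegree_of_ne_zero (by rw [htop]; exact one_ne_zero))
  refine ⟨hdeg, ?_⟩
  rw [Monic, leadingCoeff, hdeg, htop]

/-- Lists enumerate multisets: a multiset of cardinality `r` is `univ.val.map γ` for some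
`γ : Fin r → β`. [folklore] -/
theorem exists_fin_map_eq {β : Type*} {r : ℕ} (s : Multiset β) (hs : s.card = r) :
    ∃ γ : Fin r → β, univ.val.map γ = s := by
  subst hs
  have hl : s.toList.length = s.card := Multiset.length_toList s
  refine ⟨fun i => s.toList.get (Fin.cast hl.symm i), ?_⟩
  rw [Fin.univ_val_map]
  conv_rhs => rw [← Multiset.coe_toList s]
  congr 1
  apply List.ext_get
  · rw [List.length_ofFn, hl]
  · intro n h1 h2
    simp only [List.get_eq_getElem, List.getElem_ofFn, Fin.cast_mk]

/-- **Prescribed power sums.** Over an algebraically closed field of characteristic zero, for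
every `r` and every `a : ℕ → k` there is `γ : Fin r → k` with `∑ᵢ γᵢ ^ m = a m` for all
`1 ≤ m ≤ r` (the power-sum map is onto; Newton's identities in both directions plus Vieta).
[folklore] -/
theorem exists_powerSum_eq [IsAlgClosed k] [CharZero k] (r : ℕ) (a : ℕ → k) :
    ∃ γ : Fin r → k, ∀ m, 1 ≤ m → m ≤ r → ∑ i, γ i ^ m = a m := by
  obtain ⟨e, he0, he⟩ := exists_newtonRel a r
  obtain ⟨hdeg, hmonic⟩ := natDegree_newtonPoly e r he0
  set q := newtonPoly e r with hq
  have hsplit : q.Splits := IsAlgClosed.splits q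
  have hcard : q.roots.card = r := by rw [splits_iff_card_roots.1 hsplit, hdeg]
  -- Vieta: the elementary symmetric values of the roots are the `e j`
  have hesymm : ∀ j, j ≤ r → q.roots.esymm j = e j := by
    intro j hj
    have h1 := Polynomial.coeff_eq_esymm_roots_of_card (p := q) (by rw [hcard, hdeg]) (k := r - j)
      (by rw [hdeg]; omega)
    rw [hmonic.leadingCoeff, one_mul, hdeg, show r - (r - j) = j by omega,
      hq, coeff_newtonPoly e r hj] at h1
    have hu : ((-1 : k) ^ j) ≠ 0 := pow_ne_zero _ (neg_ne_zero.2 one_ne_zero)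
    exact (mul_left_cancel₀ hu h1).symm
  -- enumerate the roots and run Newton's identities forward
  obtain ⟨γ, hγ⟩ := exists_fin_map_eq q.roots hcard
  have hpsum : ∀ n, MvPolynomial.aeval γ (MvPolynomial.psum (Fin r) k n) = ∑ i, γ i ^ n := by
    intro n
    simp [MvPolynomial.psum]
  have hes : ∀ j, j ≤ r → MvPolynomial.aeval γ (MvPolynomial.esymm (Fin r) k j) = e j := by
    intro j hj
    rw [MvPolynomial.aeval_esymm_eq_multiset_esymm, hγ, hesymm j hj]
  refine ⟨γ, fun m => ?_⟩
  induction m using Nat.strong_induction_on with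
  | _ m ih =>
    intro hm1 hmr
    have H := congrArg (MvPolynomial.aeval γ)
      (MvPolynomial.psum_eq_mul_esymm_sub_sum (Fin r) k m (by omega))
    rw [hpsum, map_sub, map_mul, map_mul, map_sum, hes m hmr] at H
    rw [H, he m hm1 hmr]
    congr 1
    · simp
    · refine Finset.sum_congr rfl fun x hx => ?_
      obtain ⟨hx1, hx2⟩ := Finset.mem_filter.1 hx
      rw [Finset.HasAntidiagonal.mem_antidiagonal] at hx1
      rw [Set.mem_Ioo] at hx2
      rw [map_mul, map_mul, hes x.1 (by omega), hpsum, ih x.2 (by omega) (by omega) (by omega)]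
      simp

end Literature.RingTheory.MvPolynomial
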